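import Literature.AlgebraicGeometry.HodgeTheory.AlgebraicityLocusFibreDimension
import Literature.AlgebraicGeometry.Motives.ClosedSubvarietyOfPoint
import Literature.AlgebraicGeometry.Motives.CartierDivisorGysinProjective
import Literature.AlgebraicGeometry.Motives.CartierDivisorIdealSheaf
import Literature.AlgebraicGeometry.Motives.ProjectiveSpaceFieldPointsBijective
import Literature.AlgebraicGeometry.Resolution.AlterationsMultisectionLocalStepProofs
import Literature.AlgebraicGeometry.Morphisms.ProperIrreducibleInAffine
import Literature.AlgebraicGeometry.Dimension.FibreLocalRingDimension
import HarnessLib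

/-!
# Generic uniformity of the codimension of supports in projective families, via linear sections

Topic `Literature/AlgebraicGeometry/HodgeTheory` (family `hodge`), part of the proof programme
of the named fact `charlesSchnell_algebraicityLocus_iUnion_closed` (Charles–Schnell 2014, proof of
Prop. 11.3.11). The assembly of that proof (`AlgebraicityLocusAssembly`,
`AlgebraicityLocusFromInputs`) needs, on every irreducible closed subset `Y` of a parameter space
`T` of supports `𝒵 ⊆ 𝒳 × T`, a non-empty open part on which the condition "every point `x` with
`(x, y) ∈ 𝒵` has `height x + p ≤ n`" holds at all complex points or at none — there the input
`hC`, a consequence of Chevalley's semicontinuity of fibre dimension (EGA IV₃ 13.1.5). This file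
PROVES that input for supports inside the fibres of a proper family `f : 𝒳 ⟶ S` with `𝒳 ↪ ℙᴺ` a
preimmersion (e.g. `𝒳` quasi-projective), WITHOUT Chevalley's theorem, from the projective
dimension theorem in the (projective) fibres:

* `exists_specializes_mem_and_le_height` — ONE HYPERSURFACE SECTION: in `X` proper over `ℂ` with a
  closed immersion `ι : X ↪ ℙᴺ`, a point of height `≥ k + 1` specialises inside `V₊(F)` (`F` a form
  of positive degree) to a point of height `≥ k`: the closed subvariety `closure {x}`
  (`Motives.ClosedSubvariety.ofPoint`) meets `V₊(F)` (a positive-dimensional closed irreducible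
  subset of a proper scheme is not inside the affine `ι⁻¹ D₊(F)`,
  `Morphisms.not_subset_affineOpen_of_one_le_topologicalKrullDim`), `V₊(F)|_{closure {x}}` is an
  effective Cartier divisor (`ProjSpace.formDivisor`, `CartierDivisor.pullbackAvoiding`), and the
  generic points of the components of its support have codimension `≤ 1` (Krull,
  `Resolution.IsEffectiveCartier.exists_specializes_coheight_le_one`) in the integral
  `closure {x}` of dimension `height x` (`Dimension.coheight_add_height_eq_topologicalKrullDim`);
* `exists_specializes_forall_mem` — the PROJECTIVE DIMENSION THEOREM (Hartshorne I Thm. 7.2) in set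
  form: a point of height `≥ k` specialises into `V₊(F₁, …, F_k)` for any `k` linear forms;
* `exists_linearForm_forall_notMem` — a linear form missing finitely many points of `ℙᴺ_ℂ`;
* `exists_forms_forall_exists_notMem` — conversely a closed subset all of whose points have
  height `< k` misses `V₊(F₁, …, F_k)` for SOME linear forms (cut the components one at a time);
  `forall_height_lt_iff_exists_forms` — the two together;
* `isClosedImmersion_fiberι_comp_left` — the fibres `𝒳_t ↪ ℙᴺ` are closed immersions;
* `codim_dichotomy_of_isPreimmersion` — **the input `hC`, proved**: for fixed forms the locus of
  `y` whose support misses `ε⁻¹ V₊(F)` is the complement of the image of a closed subset of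
  `𝒳 ×_S T` under the proper projection to `T`, hence open; the codimension condition is the
  union of these loci over all `F` (by the dimension theorem in `𝒳_{hT(y)}`), an open set.

## References

* [Hartshorne1977] R. Hartshorne, Algebraic Geometry (1977), I Thm. 7.2 (projective dimension
  theorem), I Prop. 7.1, I Ex. 1.8, II Ex. 3.22.
* [EGAIV3] A. Grothendieck, J. Dieudonné, EGA IV₃, Publ. Math. IHÉS 28 (1966), Thm. 13.1.3,
  Cor. 13.1.5 (the semicontinuity statement this file makes unnecessary here).
* [CharlesSchnell2014Notes] F. Charles, C. Schnell, Notes on absolute Hodge classes (2014),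
  Prop. 11.3.11 (proof).
-/

noncomputable section

open CategoryTheory AlgebraicGeometry Limits Set Order
open _root_.Topology TopologicalSpace
open Literature.AlgebraicGeometry.Motives

universe u

namespace Literature.AlgebraicGeometry.HodgeTheory

attribute [local instance] MvPolynomial.gradedAlgebra

section HodgeTheory

variable {X : Motives.SchemeOver ℂ} [IsProper X.hom] {N : ℕ} (ι : X ⟶ projectiveSpace N ℂ)
  [IsClosedImmersion ι.left]

/-- **One hypersurface section (Krull): a point of height `≥ k + 1` specialises, inside `V₊(F)`, to
a point of height `≥ k`.** For `X` proper over `ℂ` with a closed immersion `ι : X ↪ ℙᴺ`, a form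
`F` of positive degree and a point `x` with `dim closure {x} ≥ k + 1`, some specialisation `x'`
of `x` has `ι(x') ∈ V₊(F)` and `dim closure {x'} ≥ k`: if `ι(x) ∉ V₊(F)`, the closed subvariety
`V = closure {x}` (reduced structure, `Motives.ClosedSubvariety.ofPoint`) meets `V₊(F)` (a positive
dimensional closed irreducible subset of a proper scheme is not inside the affine open
`ι⁻¹ D₊(F)`, `Morphisms.not_subset_affineOpen_of_one_le_topologicalKrullDim`), the pulled-back
divisor `V₊(F)|_V` is an effective Cartier divisor, and a generic point `ξ` of a component of its
support has codimension `≤ 1` in `V` (Krull's Hauptidealsatz,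
`Resolution.IsEffectiveCartier.exists_specializes_coheight_le_one`), hence
`height ξ ≥ dim V - 1 ≥ k` (`dim V = height x`,
`Dimension.coheight_add_height_eq_topologicalKrullDim`).
[cite: Hartshorne1977, I Thm. 7.2 and I Prop. 7.1 (proof)] -/
theorem exists_specializes_mem_and_le_height (x : X.left) {k : ℕ}
    (hk : ((k + 1 : ℕ) : ℕ∞) ≤ height x) {e : ℕ} (he : 0 < e) {F : MvPolynomial (Fin (N + 1)) ℂ}
    (hF : F ∈ MvPolynomial.homogeneousSubmodule (Fin (N + 1)) ℂ e) :
    ∃ x' : X.left, x ⤳ x' ∧ F ∈ (ι.left.base x').asHomogeneousIdeal ∧ (k : ℕ∞) ≤ height x' := by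
  classical
  have hkx : (k : ℕ∞) ≤ height x :=
    le_trans (by exact_mod_cast Nat.le_succ k) hk
  by_cases hFx : F ∈ (ι.left.base x).asHomogeneousIdeal
  · exact ⟨x, specializes_rfl, hFx, hkx⟩
  have hF0 : F ≠ 0 := fun h => hFx (h ▸ zero_mem _)
  -- standing instances
  haveI : LocallyOfFiniteType X.hom := inferInstance
  haveI : IsLocallyNoetherian X.left := LocallyOfFiniteType.isLocallyNoetherian X.hom
  -- the closed subvariety `V = closure {x}` and `g : V → ℙᴺ`
  let V := ClosedSubvariety.ofPoint X.left x
  let g : V.carrier ⟶ ProjSpace.P N ℂ := V.ι ≫ ι.left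
  have hgη : g.base (genericPoint V.carrier) = ι.left.base x := by
    change ι.left.base (V.ι.base (genericPoint V.carrier)) = _
    congr 1
    exact ClosedSubvariety.genericPoint_ofPoint (X := X.left) (x := x)
  have h₀ : (ProjSpace.formDivisor F hF hF0).Avoids (g.base (genericPoint V.carrier)) := by
    rw [hgη, ProjSpace.formDivisor_avoids_iff hF hF0 he]
    exact hFx
  -- the effective Cartier divisor `V₊(F)|_V` and its ideal sheaf
  let D := (ProjSpace.formDivisor F hF hF0).pullbackAvoiding g h₀
  have hD : D.IsEffective := (ProjSpace.isEffective_formDivisor hF hF0).pullbackAvoiding g h₀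
  have hsupp : ∀ v : V.carrier, v ∈ hD.idealSheaf.support ↔
      F ∈ (ι.left.base (V.ι.base v)).asHomogeneousIdeal := fun v => by
    rw [hD.mem_support_idealSheaf_iff,
      ProjSpace.avoids_pullbackAvoiding_formDivisor_iff g he hF hF0 h₀ v, not_not]
    rfl
  -- `V` meets `V₊(F)`: `closure {x}` is not inside the affine open `ι⁻¹ D₊(F)`
  have hmeet : ∃ v₀ : V.carrier, v₀ ∈ hD.idealSheaf.support := by
    let U : (projectiveSpace N ℂ).left.Opens :=
      Proj.basicOpen (MvPolynomial.homogeneousSubmodule (Fin (N + 1)) ℂ) F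
    have hUaff : IsAffineOpen U :=
      Proj.isAffineOpen_basicOpen (MvPolynomial.homogeneousSubmodule (Fin (N + 1)) ℂ) F hF he
    have hU : IsAffineOpen (ι.left ⁻¹ᵁ U) := hUaff.preimage ι.left
    have hdim : 1 ≤ topologicalKrullDim (closure ({x} : Set X.left)) := by
      have h1 : ((1 : ℕ) : ℕ∞) ≤ height x :=
        le_trans (by exact_mod_cast Nat.succ_le_succ k.zero_le) hk
      exact_mod_cast le_topologicalKrullDim_of_le_height isClosed_closure
        (subset_closure (mem_singleton x)) h1
    have hnot := Morphisms.not_subset_affineOpen_of_one_le_topologicalKrullDim X.hom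
      (isIrreducible_singleton.closure) isClosed_closure hdim hU
    obtain ⟨z, hzx, hzU⟩ := Set.not_subset.1 hnot
    have hxz : x ⤳ z := specializes_iff_mem_closure.2 hzx
    refine ⟨ClosedSubvariety.ofPointPt x hxz, ?_⟩
    rw [hsupp, ClosedSubvariety.ofPoint_ι_ofPointPt]
    -- `z ∉ ι⁻¹ D₊(F)` means `F ∈ 𝔭_{ι z}`
    by_contra hFz
    exact hzU hFz
  -- Krull: a generic point `ξ` of a component of the support has codimension `≤ 1` in `V`
  obtain ⟨v₀, hv₀⟩ := hmeet
  obtain ⟨ξ, hξ, -, hξ1⟩ :=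
    Resolution.IsEffectiveCartier.exists_specializes_coheight_le_one
      hD.isEffectiveCartier_idealSheaf hv₀
  refine ⟨V.ι.base ξ, ClosedSubvariety.specializes_ofPoint_ι x ξ, (hsupp ξ).1 hξ, ?_⟩
  -- dimension count in the integral `V`: `coheight ξ + height ξ = dim V = height x`
  haveI : LocallyOfFiniteType (V.ι ≫ X.hom) := inferInstance
  have h1 := Dimension.coheight_add_height_eq_topologicalKrullDim (V.ι ≫ X.hom) ξ
  have h2 := Dimension.coheight_add_height_eq_topologicalKrullDim (V.ι ≫ X.hom)
    (genericPoint V.carrier)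
  have hgen0 : coheight (genericPoint V.carrier) = 0 :=
    Order.coheight_eq_zero.2 fun y _ => genericPoint_specializes y
  have hgenh : height (genericPoint V.carrier) = height x := by
    rw [← height_base_eq_of_isClosedImmersion' V.ι (genericPoint V.carrier)]
    exact congrArg height (ClosedSubvariety.genericPoint_ofPoint (X := X.left) (x := x))
  rw [← h1, hgen0, zero_add, hgenh] at h2
  have h3 : coheight ξ + height ξ = height x := by exact_mod_cast h2.symm
  rw [height_base_eq_of_isClosedImmersion' V.ι ξ]
  -- `k + 1 ≤ coheight ξ + height ξ ≤ 1 + height ξ`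
  have h4 : ((k + 1 : ℕ) : ℕ∞) ≤ 1 + height ξ :=
    (hk.trans_eq h3.symm).trans (add_le_add hξ1 le_rfl)
  have h5 : ((k : ℕ∞) + 1) ≤ height ξ + 1 := by
    rw [add_comm (height ξ)]
    exact_mod_cast h4
  exact (ENat.add_le_add_iff_right ENat.one_ne_top).1 h5

/-- Specialisation of points of `ℙᴺ` is inclusion of homogeneous primes. [folklore] -/
theorem asHomogeneousIdeal_le_of_specializes {y y' : (projectiveSpace N ℂ).left} (h : y ⤳ y') :
    y.asHomogeneousIdeal ≤ y'.asHomogeneousIdeal :=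
  (ProjectiveSpectrum.as_ideal_le_as_ideal (MvPolynomial.homogeneousSubmodule (Fin (N + 1)) ℂ)
    y y').2 ((ProjectiveSpectrum.le_iff_mem_closure
      (MvPolynomial.homogeneousSubmodule (Fin (N + 1)) ℂ) y y').2 (specializes_iff_mem_closure.1 h))

/-- **The projective dimension theorem, set form (Hartshorne I Thm. 7.2): a closed irreducible
subset of dimension `≥ k` of a projective `ℂ`-scheme meets every `k` hyperplane sections.** For
`X` proper over `ℂ` with a closed immersion `ι : X ↪ ℙᴺ`, a point `x` with `dim closure {x} ≥ k`
and linear forms `F₁, …, F_k`, some specialisation `x'` of `x` has `ι(x') ∈ V₊(F₁, …, F_k)`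
(`exists_specializes_mem_and_le_height`, `k` times). [cite: Hartshorne1977, I Thm. 7.2] -/
theorem exists_specializes_forall_mem (x : X.left) {k : ℕ} (hk : (k : ℕ∞) ≤ height x)
    (F : Fin k → MvPolynomial (Fin (N + 1)) ℂ)
    (hF : ∀ i, F i ∈ MvPolynomial.homogeneousSubmodule (Fin (N + 1)) ℂ 1) :
    ∃ x' : X.left, x ⤳ x' ∧ ∀ i, F i ∈ (ι.left.base x').asHomogeneousIdeal := by
  induction k generalizing x with
  | zero => exact ⟨x, specializes_rfl, fun i => i.elim0⟩
  | succ k ih =>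
    obtain ⟨x₁, hxx₁, hF₁, hk₁⟩ :=
      exists_specializes_mem_and_le_height ι x hk one_pos (hF (Fin.last k))
    obtain ⟨x₂, hx₁x₂, hF₂⟩ := ih x₁ hk₁ (fun i => F (Fin.castSucc i)) fun i => hF _
    refine ⟨x₂, hxx₁.trans hx₁x₂, fun i => ?_⟩
    induction i using Fin.lastCases with
    | last =>
      exact asHomogeneousIdeal_le_of_specializes (hx₁x₂.map ι.left.continuous) hF₁
    | cast i => exact hF₂ i

/-- **A linear form missing finitely many points of `ℙᴺ_ℂ`.** Every point specialises to a closed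
point, which is a complex point `[v]` (`ℙᴺ` is Jacobson and of finite type over `ℂ`); a linear
form `Σ aᵢ xᵢ` with `Σ aᵢ vᵢ ≠ 0` for the finitely many `v` exists as `ℂ` is infinite
(`MvPolynomial.funext` applied to `∏_v Σ vᵢ xᵢ ≠ 0`), and it lies in no `𝔭_{[v]} ⊇ 𝔭_y`.
[folklore] -/
theorem exists_linearForm_forall_notMem {A : Set (projectiveSpace N ℂ).left} (hA : A.Finite) :
    ∃ F₀ : MvPolynomial (Fin (N + 1)) ℂ, F₀ ∈ MvPolynomial.homogeneousSubmodule (Fin (N + 1)) ℂ 1 ∧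
      ∀ y ∈ A, F₀ ∉ y.asHomogeneousIdeal := by
  classical
  haveI : IsProper (projectiveSpace N ℂ).hom := isProper_projectiveSpace N ℂ
  haveI : JacobsonSpace (projectiveSpace N ℂ).left :=
    LocallyOfFiniteType.jacobsonSpace (projectiveSpace N ℂ).hom
  -- every point specialises to a complex point `[v]`
  have hpt : ∀ y : (projectiveSpace N ℂ).left, ∃ (v : Fin (N + 1) → ℂ) (hv : v ≠ 0),
      y ⤳ (ProjectiveSpace.pointOfVec ℂ v hv).pt := fun y => by
    have hne : (closure ({y} : Set (projectiveSpace N ℂ).left) ∩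
        closedPoints (projectiveSpace N ℂ).left).Nonempty := by
      by_contra h
      rw [Set.not_nonempty_iff_eq_empty] at h
      have h2 := JacobsonSpace.closure_inter_closedPoints_eq_closure
        (isClosed_closure (s := ({y} : Set (projectiveSpace N ℂ).left))).isLocallyClosed
      rw [h, closure_empty, closure_closure] at h2
      exact (Set.nonempty_iff_ne_empty.1 ⟨y, subset_closure (mem_singleton y)⟩) h2.symm
    obtain ⟨q, hqy, hqc⟩ := hne
    obtain ⟨P, rfl⟩ : q ∈ Set.range
        (AlgPoints.pt : Motives.ComplexPoints (projectiveSpace N ℂ) → _) := by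
      rw [Motives.ComplexPoints.range_pt]; exact hqc
    obtain ⟨v, hv, rfl⟩ := ProjectiveSpace.exists_eq_pointOfVec P
    exact ⟨v, hv, specializes_iff_mem_closure.2 hqy⟩
  choose vec hvec hspec using hpt
  -- the product of the linear forms `Σ (vec y)ᵢ xᵢ`, `y ∈ A`, is non-zero, so has a non-zero value
  let lin : (Fin (N + 1) → ℂ) → MvPolynomial (Fin (N + 1)) ℂ := fun c =>
    ∑ i, MvPolynomial.C (c i) * MvPolynomial.X i
  have hlin1 : ∀ c, lin c ∈ MvPolynomial.homogeneousSubmodule (Fin (N + 1)) ℂ 1 := fun c => by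
    rw [MvPolynomial.mem_homogeneousSubmodule]
    refine MvPolynomial.IsHomogeneous.sum _ _ _ fun i _ => ?_
    exact MvPolynomial.isHomogeneous_C_mul_X (c i) i
  have heval : ∀ c a : Fin (N + 1) → ℂ, MvPolynomial.eval a (lin c) = ∑ i, c i * a i :=
      fun c a => by
    simp [lin, map_sum]
  have hlin0 : ∀ c : Fin (N + 1) → ℂ, c ≠ 0 → lin c ≠ 0 := fun c hc h0 => hc (by
    funext i
    have h := heval c (Pi.single i 1)
    rw [h0, map_zero] at h
    simp [Pi.single_apply, Finset.sum_ite_eq'] at h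
    simpa using h.symm)
  have hG0 : ∏ y ∈ hA.toFinset, lin (vec y) ≠ 0 :=
    Finset.prod_ne_zero_iff.2 fun y _ => hlin0 _ (hvec y)
  obtain ⟨a, ha⟩ : ∃ a : Fin (N + 1) → ℂ,
      MvPolynomial.eval a (∏ y ∈ hA.toFinset, lin (vec y)) ≠ 0 := by
    by_contra h
    push Not at h
    exact hG0 (MvPolynomial.funext fun c => by rw [h c, map_zero])
  rw [map_prod, Finset.prod_ne_zero_iff] at ha
  -- the linear form with coefficients `a`
  refine ⟨lin a, hlin1 a, fun y hy hFy => ?_⟩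
  have hay : MvPolynomial.eval a (lin (vec y)) ≠ 0 := ha y (hA.mem_toFinset.2 hy)
  -- `lin a ∈ 𝔭_y ⊆ 𝔭_{[vec y]}`, i.e. `(lin a)(vec y) = 0`
  have hmem : lin a ∈ ((ProjectiveSpace.pointOfVec ℂ (vec y) (hvec y)).pt).asHomogeneousIdeal :=
    asHomogeneousIdeal_le_of_specializes (hspec y) hFy
  have hzero : (ProjectiveSpace.pointOfVec ℂ (vec y) (hvec y)).pt ∈
      ProjectiveSpectrum.zeroLocus (MvPolynomial.homogeneousSubmodule (Fin (N + 1)) ℂ) {lin a} :=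
    (ProjectiveSpectrum.mem_zeroLocus (MvPolynomial.homogeneousSubmodule (Fin (N + 1)) ℂ)
      (ProjectiveSpace.pointOfVec ℂ (vec y) (hvec y)).pt {lin a}).2
      (Set.singleton_subset_iff.2 hmem)
  rw [ProjectiveSpace.pt_pointOfVec_mem_zeroLocus_iff (vec y) (hvec y) one_pos (hlin1 a)] at hzero
  have hzero' : MvPolynomial.eval (vec y) (lin a) = 0 := by
    rw [← hzero]
    rfl
  rw [heval] at hzero'
  apply hay
  rw [heval, ← hzero']
  exact Finset.sum_congr rfl fun i _ => mul_comm _ _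

omit [IsClosedImmersion ι.left] in
/-- **Closed subsets of dimension `< k` of a projective `ℂ`-scheme miss some `k` hyperplane
sections.** For `X` proper over `ℂ` with a closed immersion `ι : X ↪ ℙᴺ` and a closed `S ⊆ X`
all of whose points have `dim closure {z} < k`, there are linear forms `F₁, …, F_k` with
`S ∩ ι⁻¹ V₊(F₁, …, F_k) = ∅`: a linear form `F₁` missing the generic points of the components of `S`
(`exists_linearForm_forall_notMem`) cuts every component properly, so the points of `S ∩ V₊(F₁)`
have `dim closure < k - 1`; induct. [cite: Hartshorne1977, I Thm. 7.2 and I Ex. 1.8] -/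
theorem exists_forms_forall_exists_notMem {k : ℕ} {S : Set X.left} (hS : IsClosed S)
    (h : ∀ z ∈ S, height z < (k : ℕ∞)) :
    ∃ F : Fin k → MvPolynomial (Fin (N + 1)) ℂ,
      (∀ i, F i ∈ MvPolynomial.homogeneousSubmodule (Fin (N + 1)) ℂ 1) ∧
      ∀ z ∈ S, ∃ i, F i ∉ (ι.left.base z).asHomogeneousIdeal := by
  classical
  induction k generalizing S with
  | zero =>
    refine ⟨Fin.elim0, fun i => i.elim0, fun z hz => ?_⟩
    exact absurd (h z hz) (by simp)
  | succ k ih =>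
    -- `X` is Noetherian: finitely many irreducible components of `S`, with generic points `η C`
    haveI : IsLocallyNoetherian X.left := LocallyOfFiniteType.isLocallyNoetherian X.hom
    haveI : CompactSpace X.left := QuasiCompact.compactSpace_of_compactSpace X.hom
    haveI : IsNoetherian X.left := {}
    have hfin : (irreducibleComponents S).Finite := NoetherianSpace.finite_irreducibleComponents
    haveI := hfin.to_subtype
    have hCirr : ∀ C : irreducibleComponents S, IsIrreducible (Subtype.val '' (C : Set S)) :=
      fun C => (C.2.1).image _ continuous_subtype_val.continuousOn
    have hCcl : ∀ C : irreducibleComponents S, IsClosed (Subtype.val '' (C : Set S)) := fun C =>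
      hS.isClosedEmbedding_subtypeVal.isClosedMap _ (isClosed_of_mem_irreducibleComponents _ C.2)
    let η : irreducibleComponents S → X.left := fun C => (hCirr C).genericPoint
    have hη : ∀ C, IsGenericPoint (η C) (Subtype.val '' (C : Set S)) := fun C =>
      (hCirr C).isGenericPoint_genericPoint (hCcl C)
    have hηS : ∀ C, η C ∈ S := fun C => by
      obtain ⟨z, -, hz⟩ := (hη C).mem
      rw [← hz]
      exact z.2
    -- a linear form `F₀` missing the `ι (η C)`
    obtain ⟨F₀, hF₀, hF₀η⟩ :=
      exists_linearForm_forall_notMem (N := N) (Set.finite_range fun C => ι.left.base (η C))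
    -- the section `S' = S ∩ ι⁻¹ V₊(F₀)`: its points have height `< k`
    let S' : Set X.left := S ∩ {z | F₀ ∈ (ι.left.base z).asHomogeneousIdeal}
    have hS'cl : IsClosed S' := by
      refine hS.inter ?_
      have hc : IsClosed (ι.left.base ⁻¹'
          (ProjectiveSpectrum.zeroLocus (MvPolynomial.homogeneousSubmodule (Fin (N + 1)) ℂ) {F₀} :
            Set (projectiveSpace N ℂ).left)) :=
        (ProjectiveSpectrum.isClosed_zeroLocus _ _).preimage ι.left.continuous
      convert hc using 1
      ext z
      simp only [Set.mem_setOf_eq, Set.mem_preimage]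
      exact (Set.singleton_subset_iff (a := F₀)
        (s := ((ι.left.base z : ProjectiveSpectrum
          (MvPolynomial.homogeneousSubmodule (Fin (N + 1)) ℂ)).asHomogeneousIdeal :
            Set (MvPolynomial (Fin (N + 1)) ℂ)))).symm
    have hS' : ∀ z ∈ S', height z < (k : ℕ∞) := by
      rintro z ⟨hzS, hzF⟩
      let C : irreducibleComponents S :=
        ⟨irreducibleComponent (⟨z, hzS⟩ : S), irreducibleComponent_mem_irreducibleComponents _⟩
      have hzC : z ∈ Subtype.val '' (C : Set S) := ⟨⟨z, hzS⟩, mem_irreducibleComponent, rfl⟩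
      have hηz : η C ⤳ z := (hη C).specializes hzC
      have hne : ¬ z ⤳ η C := fun hzη =>
        hF₀η _ ⟨C, rfl⟩ (asHomogeneousIdeal_le_of_specializes (hzη.map ι.left.continuous) hzF)
      have hlt : z < η C := ⟨hηz, hne⟩
      have hηk : height (η C) < ((k + 1 : ℕ) : ℕ∞) := h _ (hηS C)
      have hfinz : height z < ⊤ := lt_of_le_of_lt (height_mono hlt.le) (hηk.trans_le le_top)
      have h1 : height z < height (η C) := height_strictMono hlt hfinz
      have h2 : height (η C) ≤ (k : ℕ∞) := by
        rw [Nat.cast_succ] at hηk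
        exact ENat.lt_coe_add_one_iff.1 hηk
      exact h1.trans_le h2
    obtain ⟨F', hF', hF'S⟩ := ih hS'cl hS'
    refine ⟨Fin.cons F₀ F', fun i => ?_, fun z hz => ?_⟩
    · refine Fin.cases ?_ (fun i => ?_) i
      · simpa using hF₀
      · simpa using hF' i
    · by_cases hzF : F₀ ∈ (ι.left.base z).asHomogeneousIdeal
      · obtain ⟨i, hi⟩ := hF'S z ⟨hz, hzF⟩
        exact ⟨i.succ, by simpa using hi⟩
      · exact ⟨0, by simpa using hzF⟩

/-- **Dimension of a closed subset of a projective `ℂ`-scheme via linear sections**: all points of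
the closed `S ⊆ X ↪ ℙᴺ` have `dim closure {z} < k` iff `S` misses `ι⁻¹ V₊(F₁, …, F_k)` for some
linear forms `Fᵢ` (the projective dimension theorem and its converse).
[cite: Hartshorne1977, I Thm. 7.2] -/
theorem forall_height_lt_iff_exists_forms {k : ℕ} {S : Set X.left} (hS : IsClosed S) :
    (∀ z ∈ S, height z < (k : ℕ∞)) ↔
      ∃ F : Fin k → MvPolynomial (Fin (N + 1)) ℂ,
        (∀ i, F i ∈ MvPolynomial.homogeneousSubmodule (Fin (N + 1)) ℂ 1) ∧
        ∀ z ∈ S, ∃ i, F i ∉ (ι.left.base z).asHomogeneousIdeal := by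
  refine ⟨exists_forms_forall_exists_notMem ι hS, ?_⟩
  rintro ⟨F, hF, hFS⟩ z hz
  by_contra hzk
  obtain ⟨x', hzx', hx'⟩ := exists_specializes_forall_mem ι z (not_lt.1 hzk) F hF
  obtain ⟨i, hi⟩ := hFS x' (hzx'.mem_closed hS hz)
  exact hi (hx' i)

/-! ### Generic uniformity of the codimension condition for supports in projective families -/

section Family

open MonoidalCategory CartesianMonoidalCategory

variable {𝒳 S T : Motives.SchemeOver ℂ} (f : 𝒳 ⟶ S) (hT : T ⟶ S) {N : ℕ}
  (ε : 𝒳 ⟶ projectiveSpace N ℂ)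

/-- The fibre `𝒳_t` of a proper family embeds into `ℙᴺ` by a closed immersion as soon as `𝒳` does
so by a preimmersion (`𝒳_t ↪ 𝒳` is a closed immersion, `𝒳_t → ℙᴺ` is proper). [folklore] -/
theorem isClosedImmersion_fiberι_comp_left [IsProper f.left] [LocallyOfFiniteType S.hom]
    [IsPreimmersion ε.left] (t : Motives.ComplexPoints S) :
    IsClosedImmersion (Motives.fiberι f t ≫ ε).left := by
  haveI : IsClosedImmersion t.left := AlgPoints.isClosedImmersion_toSpecHom S t
  haveI : IsClosedImmersion (Motives.fiberι f t).left :=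
    MorphismProperty.pullback_fst (P := @IsClosedImmersion) f.left t.left inferInstance
  haveI : IsPreimmersion (Motives.fiberι f t ≫ ε).left := by
    rw [Over.comp_left]
    infer_instance
  haveI : IsProper (Motives.fiberOver f t).hom := isProper_fiberOver_hom f t
  haveI : IsProper (projectiveSpace N ℂ).hom := isProper_projectiveSpace N ℂ
  haveI : IsProper ((Motives.fiberι f t ≫ ε).left ≫ (projectiveSpace N ℂ).hom) := by
    rw [Over.w]
    infer_instance
  haveI : IsProper (Motives.fiberι f t ≫ ε).left :=
    IsProper.of_comp (Motives.fiberι f t ≫ ε).left (projectiveSpace N ℂ).hom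
  exact IsClosedImmersion.of_isPreimmersion _
    (Motives.fiberι f t ≫ ε).left.isClosedMap.isClosed_range

/-- The commutativity making `𝒳 ×_S T → 𝒳 × T` well defined. [folklore] -/
theorem pullback_fst_comp_hom_eq :
    pullback.fst f.left hT.left ≫ 𝒳.hom = pullback.snd f.left hT.left ≫ T.hom := by
  rw [← Over.w f, ← Category.assoc, pullback.condition, Category.assoc, Over.w hT]

/-- For a complex point `y` of `T` over `t = hT(y)`, the map `𝒳_t → 𝒳 ×_S T`, `z ↦ (ι_t z, y)`, is
well defined. [folklore] -/
theorem fiberι_left_comp_eq (y : Motives.ComplexPoints T) :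
    (Motives.fiberι f (AlgPoints.map hT y)).left ≫ f.left =
      (Motives.fiberOverToSpec f (AlgPoints.map hT y) ≫ y).left ≫ hT.left := by
  have h := congrArg CommaMorphism.left (Motives.fiberι_comp f (AlgPoints.map hT y))
  simp only [Over.comp_left] at h
  rw [h, AlgPoints.map_apply, Over.comp_left, Over.comp_left, Category.assoc]

/-- **Generic uniformity of the codimension condition (the input `hC` of
`charlesSchnell_algebraicityLocus_iUnion_closed_of_inputs`), proved.** Let `f : 𝒳 ⟶ S` be proper,
`S` and `T` locally of finite type over `ℂ`, `hT : T ⟶ S`, `ε : 𝒳 ⟶ ℙᴺ` a preimmersion, and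
`𝒵 ⊆ 𝒳 × T` a closed subset whose slice over every complex point `y` lies in the fibre
`𝒳_{hT(y)}`. Then on every irreducible closed `Y ⊆ T` the condition "every `x` with `(x, y) ∈ 𝒵`
has `height x + p ≤ n`" holds at all complex points of a non-empty open part of `Y` or at none.
Proof: by the projective dimension theorem in the projective fibres
(`forall_height_lt_iff_exists_forms` for `𝒳_t ↪ ℙᴺ`), the condition says that the slice misses
`ε⁻¹ V₊(F₁, …, F_k)` for SOME linear forms, `k = n + 1 - p`; for fixed forms this locus is the
complement of the image of a closed subset of `𝒳 ×_S T` under the proper projection to `T`, hence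
open; so the locus of the condition is the trace on complex points of an open subset of `T`.
[cite: Hartshorne1977, I Thm. 7.2] [cite: EGAIV3, Thm. 13.1.3 (the statement it replaces)] -/
theorem codim_dichotomy_of_isPreimmersion [IsProper f.left] [LocallyOfFiniteType S.hom]
    [LocallyOfFiniteType T.hom] [IsPreimmersion ε.left] {𝒵 : Set (𝒳 ⊗ T).left}
    (h𝒵 : IsClosed 𝒵)
    (hgraph : ∀ (y : Motives.ComplexPoints T) (x : 𝒳.left), (sliceAt 𝒳 y).left.base x ∈ 𝒵 →
      f.left.base x = (AlgPoints.map hT y).pt)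
    (p n : ℕ) {Y : Set T.left} (hY : IsIrreducible Y) :
    ∃ O : T.left.Opens, (Y ∩ (O : Set T.left)).Nonempty ∧
      ((∀ y : Motives.ComplexPoints T, y.pt ∈ Y ∧ y.pt ∈ (O : Set T.left) →
          ∀ x : 𝒳.left, (sliceAt 𝒳 y).left.base x ∈ 𝒵 → height x + p ≤ (n : ℕ∞)) ∨
        (∀ y : Motives.ComplexPoints T, y.pt ∈ Y ∧ y.pt ∈ (O : Set T.left) →
          ¬ ∀ x : 𝒳.left, (sliceAt 𝒳 y).left.base x ∈ 𝒵 → height x + p ≤ (n : ℕ∞))) := by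
  classical
  -- the proper projection `Φ : 𝒳 ×_S T → T` and the map `m : 𝒳 ×_S T → 𝒳 × T`
  let Φ : pullback f.left hT.left ⟶ T.left := pullback.snd f.left hT.left
  let m : pullback f.left hT.left ⟶ (𝒳 ⊗ T).left :=
    pullback.lift (pullback.fst f.left hT.left) (pullback.snd f.left hT.left)
      (pullback_fst_comp_hom_eq f hT)
  have hm1 : m ≫ (CartesianMonoidalCategory.fst 𝒳 T).left = pullback.fst f.left hT.left :=
    pullback.lift_fst _ _ _
  have hm2 : m ≫ (CartesianMonoidalCategory.snd 𝒳 T).left = Φ := pullback.lift_snd _ _ _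
  have hmfst : ∀ q, (CartesianMonoidalCategory.fst 𝒳 T).left.base (m.base q) =
      (pullback.fst f.left hT.left).base q := fun q => by
    change (m ≫ (CartesianMonoidalCategory.fst 𝒳 T).left).base q = _
    rw [hm1]
  have hmsnd : ∀ q, (CartesianMonoidalCategory.snd 𝒳 T).left.base (m.base q) = Φ.base q :=
    fun q => by
    change (m ≫ (CartesianMonoidalCategory.snd 𝒳 T).left).base q = _
    rw [hm2]
  have hΦcl : IsClosedMap Φ.base := (pullback.snd f.left hT.left).isClosedMap
  -- the test sets: supports meeting `ε⁻¹ V₊(F)` for a tuple of forms `F`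
  let k : ℕ := n + 1 - p
  let CF : (Fin k → MvPolynomial (Fin (N + 1)) ℂ) → Set (𝒳 ⊗ T).left := fun F =>
    {w | ∀ i,
      F i ∈ (ε.left.base ((CartesianMonoidalCategory.fst 𝒳 T).left.base w)).asHomogeneousIdeal}
  have hCF : ∀ F, IsClosed (CF F) := fun F => by
    have h1 : CF F = ⋂ i, ((CartesianMonoidalCategory.fst 𝒳 T).left.base ⁻¹' (ε.left.base ⁻¹'
        (ProjectiveSpectrum.zeroLocus (MvPolynomial.homogeneousSubmodule (Fin (N + 1)) ℂ) {F i} :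
          Set (projectiveSpace N ℂ).left))) := by
      ext w
      simp only [CF, Set.mem_setOf_eq, Set.mem_iInter, Set.mem_preimage]
      refine forall_congr' fun i => ?_
      exact (Set.singleton_subset_iff (a := F i)
        (s := ((ε.left.base ((CartesianMonoidalCategory.fst 𝒳 T).left.base w) : ProjectiveSpectrum
          (MvPolynomial.homogeneousSubmodule (Fin (N + 1)) ℂ)).asHomogeneousIdeal :
            Set (MvPolynomial (Fin (N + 1)) ℂ)))).symm
    rw [h1]
    exact isClosed_iInter fun i => ((ProjectiveSpectrum.isClosed_zeroLocus _ _).preimage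
      ε.left.continuous).preimage (CartesianMonoidalCategory.fst 𝒳 T).left.continuous
  let B : (Fin k → MvPolynomial (Fin (N + 1)) ℂ) → Set T.left := fun F =>
    Φ.base '' (m.base ⁻¹' (𝒵 ∩ CF F))
  have hB : ∀ F, IsClosed (B F) := fun F =>
    hΦcl _ ((h𝒵.inter (hCF F)).preimage m.continuous)
  -- the open set
  let O : T.left.Opens :=
    ⟨⋃ F : {F : Fin k → MvPolynomial (Fin (N + 1)) ℂ //
        ∀ i, F i ∈ MvPolynomial.homogeneousSubmodule (Fin (N + 1)) ℂ 1}, (B F.1)ᶜ,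
      isOpen_iUnion fun F => (hB F.1).isOpen_compl⟩
  -- pointwise description at a complex point `y` over `t`
  have key : ∀ y : Motives.ComplexPoints T, y.pt ∈ (O : Set T.left) ↔
      ∀ x : 𝒳.left, (sliceAt 𝒳 y).left.base x ∈ 𝒵 → height x + p ≤ (n : ℕ∞) := by
    intro y
    have hk : ∀ a : ℕ∞, a + p ≤ (n : ℕ∞) ↔ a < (k : ℕ∞) := fun a => height_add_le_iff_lt_sub a p n
    -- the fibre over `t = hT(y)`, projective via `ι_t ≫ ε`
    haveI := isClosedImmersion_fiberι_comp_left f ε (AlgPoints.map hT y)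
    haveI : IsProper (Motives.fiberOver f (AlgPoints.map hT y)).hom := isProper_fiberOver_hom f _
    -- the slice as a closed subset `Zy` of the fibre
    let Zy : Set (Motives.fiberOver f (AlgPoints.map hT y)).left :=
      {z | (sliceAt 𝒳 y).left.base ((Motives.fiberι f (AlgPoints.map hT y)).left.base z) ∈ 𝒵}
    have hZy : IsClosed Zy := h𝒵.preimage
      ((sliceAt 𝒳 y).left.continuous.comp (Motives.fiberι f (AlgPoints.map hT y)).left.continuous)
    -- the section `q' : 𝒳_t → 𝒳 ×_S T`, `z ↦ (ι_t z, y)`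
    let q' : (Motives.fiberOver f (AlgPoints.map hT y)).left ⟶ pullback f.left hT.left :=
      pullback.lift (Motives.fiberι f (AlgPoints.map hT y)).left
        (Motives.fiberOverToSpec f (AlgPoints.map hT y) ≫ y).left (fiberι_left_comp_eq f hT y)
    have hq'1 : q' ≫ pullback.fst f.left hT.left = (Motives.fiberι f (AlgPoints.map hT y)).left :=
      pullback.lift_fst _ _ _
    have hq'2 : q' ≫ Φ = (Motives.fiberOverToSpec f (AlgPoints.map hT y) ≫ y).left :=
      pullback.lift_snd _ _ _
    have hq'm : ∀ z, m.base (q'.base z) =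
        (sliceAt 𝒳 y).left.base ((Motives.fiberι f (AlgPoints.map hT y)).left.base z) := by
      intro z
      have h1 : q' ≫ m = (CartesianMonoidalCategory.lift (Motives.fiberι f (AlgPoints.map hT y))
          (Motives.fiberOverToSpec f (AlgPoints.map hT y) ≫ y)).left := by
        apply pullback.hom_ext
        · show (q' ≫ m) ≫ (CartesianMonoidalCategory.fst 𝒳 T).left =
            (CartesianMonoidalCategory.lift (Motives.fiberι f (AlgPoints.map hT y))
              (Motives.fiberOverToSpec f (AlgPoints.map hT y) ≫ y)).left ≫
              (CartesianMonoidalCategory.fst 𝒳 T).left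
          rw [Category.assoc, hm1, hq'1, ← Over.comp_left, CartesianMonoidalCategory.lift_fst]
        · show (q' ≫ m) ≫ (CartesianMonoidalCategory.snd 𝒳 T).left =
            (CartesianMonoidalCategory.lift (Motives.fiberι f (AlgPoints.map hT y))
              (Motives.fiberOverToSpec f (AlgPoints.map hT y) ≫ y)).left ≫
              (CartesianMonoidalCategory.snd 𝒳 T).left
          rw [Category.assoc, hm2, hq'2, ← Over.comp_left, CartesianMonoidalCategory.lift_snd]
      have h2 := congrArg (fun φ => φ.base z) h1
      simp only [Scheme.Hom.comp_base, TopCat.coe_comp, Function.comp_apply] at h2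
      rw [h2]
      exact lift_fiberι_base_apply f (AlgPoints.map hT y) y z
    have hq'Φ : ∀ z, Φ.base (q'.base z) = y.pt := by
      intro z
      have h2 := congrArg (fun φ => φ.base z) hq'2
      simp only [Scheme.Hom.comp_base, TopCat.coe_comp, Function.comp_apply, Over.comp_left] at h2
      rw [h2]
      haveI : Unique ↥(specOver ℂ ℂ).left := inferInstanceAs (Unique (PrimeSpectrum ℂ))
      rw [Subsingleton.elim ((Motives.fiberOverToSpec f (AlgPoints.map hT y)).left.base z)
        (IsLocalRing.closedPoint ℂ)]
      rfl
    have hq'fst : ∀ z, (CartesianMonoidalCategory.fst 𝒳 T).left.base (m.base (q'.base z)) =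
        (Motives.fiberι f (AlgPoints.map hT y)).left.base z := fun z => by
      rw [hmfst]
      change (q' ≫ pullback.fst f.left hT.left).base z = _
      rw [hq'1]
    -- `y ∉ B F` iff the slice misses `ε⁻¹ V₊(F)`
    have hBiff : ∀ F : Fin k → MvPolynomial (Fin (N + 1)) ℂ, y.pt ∉ B F ↔
        ∀ z ∈ Zy, ∃ i,
          F i ∉ ((Motives.fiberι f (AlgPoints.map hT y) ≫ ε).left.base z).asHomogeneousIdeal := by
      intro F
      constructor
      · intro hyB z hz
        by_contra hall
        push Not at hall
        refine hyB ⟨q'.base z, ⟨?_, fun i => ?_⟩, hq'Φ z⟩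
        · show m.base (q'.base z) ∈ 𝒵
          rw [hq'm]
          exact hz
        · rw [hq'fst]
          exact hall i
      · rintro hZ ⟨q, ⟨hq𝒵, hqC⟩, hqy⟩
        obtain ⟨x, hx⟩ := exists_sliceAt_base_eq y (m.base q) (by rw [hmsnd]; exact hqy)
        have hx𝒵 : (sliceAt 𝒳 y).left.base x ∈ 𝒵 := by
          rw [hx]
          exact hq𝒵
        obtain ⟨z, rfl⟩ := exists_fiberι_base_eq f (AlgPoints.map hT y) x (hgraph y x hx𝒵)
        obtain ⟨i, hi⟩ := hZ z hx𝒵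
        apply hi
        have hfst : (CartesianMonoidalCategory.fst 𝒳 T).left.base (m.base q) =
            (Motives.fiberι f (AlgPoints.map hT y)).left.base z := by
          rw [← hx]
          change (sliceAt 𝒳 y ≫ CartesianMonoidalCategory.fst 𝒳 T).left.base _ = _
          rw [sliceAt_fst]
          rfl
        have h := hqC i
        rw [hfst] at h
        exact h
    -- assemble with the projective dimension theorem in the fibre
    have hmemO : y.pt ∈ (O : Set T.left) ↔
        ∃ F : {F : Fin k → MvPolynomial (Fin (N + 1)) ℂ //
          ∀ i, F i ∈ MvPolynomial.homogeneousSubmodule (Fin (N + 1)) ℂ 1}, y.pt ∉ B F.1 := by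
      change y.pt ∈ ⋃ F : {F : Fin k → MvPolynomial (Fin (N + 1)) ℂ //
        ∀ i, F i ∈ MvPolynomial.homogeneousSubmodule (Fin (N + 1)) ℂ 1}, (B F.1)ᶜ ↔ _
      simp only [Set.mem_iUnion, Set.mem_compl_iff]
    rw [hmemO]
    constructor
    · rintro ⟨F, hF⟩ x hx
      rw [hk]
      obtain ⟨z, rfl⟩ := exists_fiberι_base_eq f (AlgPoints.map hT y) x (hgraph y x hx)
      rw [height_fiberι_base_eq f (AlgPoints.map hT y) z]
      exact (forall_height_lt_iff_exists_forms (Motives.fiberι f (AlgPoints.map hT y) ≫ ε) hZy).2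
        ⟨F.1, F.2, (hBiff F.1).1 hF⟩ z hx
    · intro hgood
      have hZlt : ∀ z ∈ Zy, height z < (k : ℕ∞) := fun z hz => by
        rw [← height_fiberι_base_eq f (AlgPoints.map hT y) z, ← hk]
        exact hgood _ hz
      obtain ⟨F, hF, hFZ⟩ :=
        (forall_height_lt_iff_exists_forms (Motives.fiberι f (AlgPoints.map hT y) ≫ ε) hZy).1 hZlt
      exact ⟨⟨F, hF⟩, (hBiff F).2 hFZ⟩
  by_cases hYO : (Y ∩ (O : Set T.left)).Nonempty
  · exact ⟨O, hYO, Or.inl fun y hy => (key y).1 hy.2⟩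
  · refine ⟨⊤, ?_, Or.inr fun y hy hgood => hYO ⟨y.pt, hy.1, (key y).2 hgood⟩⟩
    rw [TopologicalSpace.Opens.coe_top, Set.inter_univ]
    exact hY.nonempty

end Family

end HodgeTheory

end Literature.AlgebraicGeometry.HodgeTheory

end
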